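import Summits.QuantumFields.YangMills.Theorems.SwapVirialDeficitZeroModeSigmaFourSmallBallScaling
import HarnessLib

/-!
# Exact zero-mode rung Z5 — the σ-TWISTED FOUR-LEADER small ball, IV-a: the `t`-free dominator (pointwise)
# (LEAD ym-line-sfw-p2 g93 07:46Z «`Haar⁴{E_σ(t)} = v₇t⁷(1 + O(t^θ))`»; free-hands support of ⟨stmt-QuantumFields-24197⟩)

For the dominated-convergence step of the σ-twisted small-ball limit one needs a `t`-FREE integrable majorant of the indicators of the rescaled
events `rescaledSigma t A` (part II).  It is built from the FOUR LOAD-BEARING CONSTRAINTS of LEAD g93's ceiling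
(✓`SigmaTwistedLetterCeilingAlgebra`: «dropping any one of the four would produce a spurious log or the exponent 6»), read in the blown-up
coordinates `x' = D_t x`, `y' = D_t y`, `z' = D³_t z` at an axial hub unit `A = (α, β, 0, 0)`:
* (a) `‖[x̂', ŷ']‖ ≤ t`            ⟹ `4|x_I y_⊥ − y_I x_⊥|² ≤ 1`                 (✓`norm_comm_dilate_sq`);
* (b) `‖[A, ŷ']‖ ≤ t`             ⟹ `4β²|y_⊥|² ≤ 1`                            (✓`norm_comm_axial_sq`);
* (c) `|α|·‖[A, x̂']‖ ≤ 2t`        ⟹ `α²β²|x_⊥|² ≤ 1`                           (✓`abs_re_mul_norm_comm_le`, from the two seam relations);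
* (d) `‖[x̂', Ā x̂' A]‖ ≤ 3t`       ⟹ `(16/9)β²x_I²|x_⊥|² ≤ 1`                   (✓`norm_comm_conj_le` + ✓`sixteen_mul_le_norm_comm_conj_sq`);
together with the coordinate boxes `x₀², x_I², y₀², y_I², z₀², ζ_I², ζ_J², ζ_K² < 1` (the last three from the first seam relation
`‖ẑ' − 1‖ ≤ t`, ✓`norm_seam0_translate`).  Gaussianising (`𝟙{Q ≤ 1} ≤ e·e^{−Q}`, fcl-p3 g44's trick of Z4-IV) gives
`sigmaDom A = 𝟙_boxes · exp(4 − Q_a − Q_b − Q_c − Q_d)` and ★★ `indicator_rescaledSigma_le_sigmaDom` for all `0 < t ≤ 1`.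
Part IV-b integrates it: two shifted 2D Gaussians `π²/(4β²[(β²+x_I²)(α²+(16/9)x_I²) + 4y_I²])`, AM–GM, and the hub integral — finite, no logarithm.
HONEST LABEL: finite-dimensional measure theory on `SU(2)⁴` (plan-level zero-mode rung of the DRAFT line «sharp-sigma»); NOT the fixed-`L` sharp law,
NOT ⟨24197⟩; own crux ⟨22884⟩ OPEN (blocked-on ⟨19935⟩); the Yang–Mills mass gap is NOT proved; no summit is proved by a line.
Width seat ym-line-sfw-p2-w3 g63 (cell ym-idea-1, free hands), `--supports stmt-QuantumFields-24197`.  Standard axioms, 0 `sorry`.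
References: [cite: GonzalezarroyoAltes1988]; [cite: Vanbaal2001]; [cite: Luscher1983, §2]; [folklore].
-/

set_option autoImplicit false

noncomputable section

open MeasureTheory Quaternion Set
open scoped Quaternion ENNReal BigOperators
open Literature.MathematicalPhysics.QuantumLattice
open Literature.MathematicalPhysics.QuantumFieldTheory (haarProbability)
open Literature.Analysis.Calculus (radialUnit radialUnit_def norm_radialUnit)
open Summit.QuantumFields.YangMills.Theorems.SwapTwistDeficit.ToronLog
open Summit.QuantumFields.YangMills.Theorems.ToronValleyVolume.NearlyCommutingCeiling (norm_conj_of_norm_eq_one sq_norm_im_eq)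
open Summit.QuantumFields.YangMills.Theorems.SwapVirialDeficit.ZeroModeGroup
open Summit.QuantumFields.YangMills.Theorems.SwapVirialDeficit.SigmaTwistedCeiling
open Summit.QuantumFields.YangMills.Theorems.UV3WindowNetSU2 (abs_imI_le_norm abs_imJ_le_norm abs_imK_le_norm)

attribute [local instance] Literature.Analysis.FluidPDE.Tao2016.quatMeasurableSpace
  Literature.Analysis.FluidPDE.Tao2016.quatBorelSpace
  Literature.MathematicalPhysics.QuantumLattice.secondCountableTopology_su2

namespace Summit.QuantumFields.YangMills.Theorems.SwapVirialDeficit.ZeroModeSigma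

/-! ## §11 The load quadratic form and the dominator -/

/-- **The load form** `Q_a + Q_b + Q_c + Q_d` of the four load-bearing constraints at an axial hub unit `A = (α, β, 0, 0)`:
`4|x_I y_⊥ − y_I x_⊥|² + 4β²|y_⊥|² + α²β²|x_⊥|² + (16/9)β²x_I²|x_⊥|²`. [folklore] -/
def qLoad (A x y : ℍ) : ℝ :=
  4 * ((x.imK * y.imI - x.imI * y.imK) ^ 2 + (x.imI * y.imJ - x.imJ * y.imI) ^ 2) +
    4 * (A.imI ^ 2 * (y.imJ ^ 2 + y.imK ^ 2)) + A.re ^ 2 * A.imI ^ 2 * (x.imJ ^ 2 + x.imK ^ 2) +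
    16 / 9 * (A.imI ^ 2 * x.imI ^ 2 * (x.imJ ^ 2 + x.imK ^ 2))

/-- Unfolding `qLoad`. [folklore] -/
theorem qLoad_def (A x y : ℍ) : qLoad A x y =
    4 * ((x.imK * y.imI - x.imI * y.imK) ^ 2 + (x.imI * y.imJ - x.imJ * y.imI) ^ 2) +
      4 * (A.imI ^ 2 * (y.imJ ^ 2 + y.imK ^ 2)) + A.re ^ 2 * A.imI ^ 2 * (x.imJ ^ 2 + x.imK ^ 2) +
      16 / 9 * (A.imI ^ 2 * x.imI ^ 2 * (x.imJ ^ 2 + x.imK ^ 2)) := rfl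

/-- The axial coordinate box of a pair letter: `x₀² < 1 ∧ x_I² < 1`. [folklore] -/
def axBox : Set ℍ := {x | x.re ^ 2 < 1 ∧ x.imI ^ 2 < 1}

/-- The coordinate box of the slaved letter: all four coordinates squared `< 1`. [folklore] -/
def zBox : Set ℍ := {z | z.re ^ 2 < 1 ∧ z.imI ^ 2 < 1 ∧ z.imJ ^ 2 < 1 ∧ z.imK ^ 2 < 1}

/-- ★ **The `t`-free dominator** `sigmaDom A ((x, y), z) = 𝟙_axBox(x)·𝟙_axBox(y)·𝟙_zBox(z)·exp(4 − qLoad A x y)`. [folklore] -/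
def sigmaDom (A : ℍ) (w : (ℍ × ℍ) × ℍ) : ℝ≥0∞ :=
  axBox.indicator (fun _ => (1 : ℝ≥0∞)) w.1.1 * axBox.indicator (fun _ => (1 : ℝ≥0∞)) w.1.2 *
    zBox.indicator (fun _ => (1 : ℝ≥0∞)) w.2 * ENNReal.ofReal (Real.exp (4 - qLoad A w.1.1 w.1.2))

/-- Unfolding `sigmaDom`. [folklore] -/
theorem sigmaDom_def (A : ℍ) (w : (ℍ × ℍ) × ℍ) : sigmaDom A w =
    axBox.indicator (fun _ => (1 : ℝ≥0∞)) w.1.1 * axBox.indicator (fun _ => (1 : ℝ≥0∞)) w.1.2 *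
      zBox.indicator (fun _ => (1 : ℝ≥0∞)) w.2 * ENNReal.ofReal (Real.exp (4 - qLoad A w.1.1 w.1.2)) := rfl

/-! ## §12 Coordinates of the dilated and normalised letters -/

/-- Components of a unit vector: `(radialUnit v).re = v.re/‖v‖` etc. [folklore] -/
theorem radialUnit_components (v : ℍ) :
    (radialUnit v).re = ‖v‖⁻¹ * v.re ∧ (radialUnit v).imI = ‖v‖⁻¹ * v.imI ∧ (radialUnit v).imJ = ‖v‖⁻¹ * v.imJ ∧
      (radialUnit v).imK = ‖v‖⁻¹ * v.imK := by
  simp only [radialUnit_def, Quaternion.re_smul, Quaternion.imI_smul, Quaternion.imJ_smul, Quaternion.imK_smul, smul_eq_mul, and_self]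

/-- `v = ‖v‖ • radialUnit v` for every `v` (both sides vanish at `v = 0`). [folklore] -/
theorem norm_smul_radialUnit (v : ℍ) : ‖v‖ • radialUnit v = v := by
  by_cases hv : v = 0
  · rw [hv, norm_zero, zero_smul]
  · rw [radialUnit_def, smul_smul, mul_inv_cancel₀ (norm_ne_zero_iff.2 hv), one_smul]

/-- Coordinates versus unit-vector coordinates: `v_c = ‖v‖·(radialUnit v)_c` for all four coordinates and every `v`. [folklore] -/
theorem coords_eq_norm_mul_radialUnit (v : ℍ) :
    v.re = ‖v‖ * (radialUnit v).re ∧ v.imI = ‖v‖ * (radialUnit v).imI ∧ v.imJ = ‖v‖ * (radialUnit v).imJ ∧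
      v.imK = ‖v‖ * (radialUnit v).imK := by
  have h := norm_smul_radialUnit v
  refine ⟨?_, ?_, ?_, ?_⟩
  · conv_lhs => rw [← h]
    rw [Quaternion.re_smul, smul_eq_mul]
  · conv_lhs => rw [← h]
    rw [Quaternion.imI_smul, smul_eq_mul]
  · conv_lhs => rw [← h]
    rw [Quaternion.imJ_smul, smul_eq_mul]
  · conv_lhs => rw [← h]
    rw [Quaternion.imK_smul, smul_eq_mul]

/-- Commutator of two letters versus commutator of their unit vectors: `‖xy − yx‖ = ‖x‖‖y‖·‖x̂ŷ − ŷx̂‖` for all `x, y`. [folklore] -/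
theorem norm_comm_eq_norm_mul_radialUnit (x y : ℍ) :
    ‖x * y - y * x‖ = ‖x‖ * ‖y‖ * ‖radialUnit x * radialUnit y - radialUnit y * radialUnit x‖ := by
  conv_lhs => rw [← norm_smul_radialUnit x, ← norm_smul_radialUnit y]
  rw [norm_comm_smul, abs_of_nonneg (norm_nonneg _), abs_of_nonneg (norm_nonneg _)]

/-- `‖radialUnit v‖ ≤ 1` for every `v`. [folklore] -/
theorem norm_radialUnit_le_one (v : ℍ) : ‖radialUnit v‖ ≤ 1 := by
  by_cases hv : v = 0
  · rw [hv, radialUnit_def, smul_zero, norm_zero]; exact zero_le_one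
  · rw [norm_radialUnit hv]

/-- An axial unit `A` (`A_J = A_K = 0`, `‖A‖ = 1`) has `A_0² + A_I² = 1`. [folklore] -/
theorem axial_sq_add_sq {A : ℍ} (hA : ‖A‖ = 1) (hJ : A.imJ = 0) (hK : A.imK = 0) : A.re ^ 2 + A.imI ^ 2 = 1 := by
  have h := sq_norm_eq_sum_sq A
  rw [hA, hJ, hK] at h
  linarith

/-- The axial hub unit `A = radialUnit (axisPoint a)` is axial (`A_J = A_K = 0`). [folklore] -/
theorem axisUnit_axial (a : ℍ) : (radialUnit (axisPoint a)).imJ = 0 ∧ (radialUnit (axisPoint a)).imK = 0 := by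
  obtain ⟨-, -, hJ, hK⟩ := radialUnit_components (axisPoint a)
  have hcomp := axisPoint_components a
  exact ⟨by rw [hJ, hcomp.2.2.1, mul_zero], by rw [hK, hcomp.2.2.2, mul_zero]⟩

/-! ## §13 The coordinate boxes on the rescaled event -/

/-- From `‖D_t x‖ < 1`: `x₀² < 1` and `x_I² < 1`. [folklore] -/
theorem mem_axBox_of_norm_dilate_lt {t : ℝ} {x : ℍ} (h : ‖dilate t x‖ < 1) : x ∈ axBox := by
  have h2 : ‖dilate t x‖ ^ 2 < 1 := by
    have h0 : 0 ≤ ‖dilate t x‖ := norm_nonneg _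
    nlinarith
  rw [norm_sq_dilate] at h2
  have ht : 0 ≤ t ^ 2 * (x.imJ ^ 2 + x.imK ^ 2) := by positivity
  exact ⟨by nlinarith [sq_nonneg x.imI], by nlinarith [sq_nonneg x.re]⟩

/-- A coordinate bound through the unit vector: if `|(radialUnit v)_c| ≤ t` and `v_c = t·u`, `‖v‖ < 1`, `0 < t`, then `u² < 1`. [folklore] -/
theorem sq_lt_one_of_unit_coord {t u vc : ℝ} {v : ℍ} (ht : 0 < t) (hv : ‖v‖ < 1) (hvc : vc = ‖v‖ * (‖v‖⁻¹ * vc))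
    (hc : vc = t * u) (hb : |‖v‖⁻¹ * vc| ≤ t) : u ^ 2 < 1 := by
  have hn : 0 ≤ ‖v‖ := norm_nonneg v
  have h1 : |vc| ≤ ‖v‖ * t := by
    rw [hvc, abs_mul, abs_of_nonneg hn]
    exact mul_le_mul_of_nonneg_left hb hn
  rw [hc, abs_mul, abs_of_pos ht] at h1
  have h2 : |u| ≤ ‖v‖ := by nlinarith
  have h3 : |u| < 1 := lt_of_le_of_lt h2 hv
  have h4 : 0 ≤ |u| := abs_nonneg u
  nlinarith [sq_abs u]

/-- ★ From `‖D³_t z‖ < 1` and the first seam relation in translated form `‖radialUnit (D³_t z) − 1‖ ≤ t` (`0 < t`): `z ∈ zBox`. [folklore] -/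
theorem mem_zBox_of_seam0 {t : ℝ} (ht : 0 < t) {z : ℍ} (hn : ‖dilateIm t z‖ < 1) (hs : ‖radialUnit (dilateIm t z) - 1‖ ≤ t) : z ∈ zBox := by
  set v := dilateIm t z with hv
  obtain ⟨-, hI, hJ, hK⟩ := radialUnit_components v
  obtain ⟨-, cI, cJ, cK⟩ := coords_eq_norm_mul_radialUnit v
  -- the imaginary coordinates of `radialUnit v − 1` are those of `radialUnit v`
  have eI : (radialUnit v - 1).imI = (radialUnit v).imI := by simp
  have eJ : (radialUnit v - 1).imJ = (radialUnit v).imJ := by simp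
  have eK : (radialUnit v - 1).imK = (radialUnit v).imK := by simp
  have bI : |‖v‖⁻¹ * v.imI| ≤ t := by rw [← hI, ← eI]; exact (abs_imI_le_norm _).trans hs
  have bJ : |‖v‖⁻¹ * v.imJ| ≤ t := by rw [← hJ, ← eJ]; exact (abs_imJ_le_norm _).trans hs
  have bK : |‖v‖⁻¹ * v.imK| ≤ t := by rw [← hK, ← eK]; exact (abs_imK_le_norm _).trans hs
  rw [hI] at cI; rw [hJ] at cJ; rw [hK] at cK
  refine ⟨?_, sq_lt_one_of_unit_coord ht hn cI (dilateIm_imI t z) bI, sq_lt_one_of_unit_coord ht hn cJ (dilateIm_imJ t z) bJ,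
    sq_lt_one_of_unit_coord ht hn cK (dilateIm_imK t z) bK⟩
  -- `z₀² = (D³_t z)₀² ≤ ‖D³_t z‖² < 1`
  have h2 : ‖v‖ ^ 2 < 1 := by
    have h0 : 0 ≤ ‖v‖ := norm_nonneg _
    nlinarith
  rw [norm_sq_dilateIm] at h2
  have hpos : 0 ≤ t ^ 2 * (z.imI ^ 2 + z.imJ ^ 2 + z.imK ^ 2) := by positivity
  linarith

/-! ## §14 The four load-bearing constraints on the rescaled event -/

/-- **(a)** from `‖[x̂', ŷ']‖ ≤ t` (`x' = D_t x`, `y' = D_t y` in the unit balls, `0 < t`): `4|x_I y_⊥ − y_I x_⊥|² ≤ 1`. [folklore] -/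
theorem loadA_le_one {t : ℝ} (ht : 0 < t) {x y : ℍ} (hx : ‖dilate t x‖ < 1) (hy : ‖dilate t y‖ < 1)
    (h : ‖radialUnit (dilate t x) * radialUnit (dilate t y) - radialUnit (dilate t y) * radialUnit (dilate t x)‖ ≤ t) :
    4 * ((x.imK * y.imI - x.imI * y.imK) ^ 2 + (x.imI * y.imJ - x.imJ * y.imI) ^ 2) ≤ 1 := by
  have h1 : ‖dilate t x * dilate t y - dilate t y * dilate t x‖ ≤ t := by
    rw [norm_comm_eq_norm_mul_radialUnit]
    calc ‖dilate t x‖ * ‖dilate t y‖ * ‖radialUnit (dilate t x) * radialUnit (dilate t y) - radialUnit (dilate t y) * radialUnit (dilate t x)‖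
        ≤ 1 * 1 * t := by gcongr
      _ = t := by ring
  have h2 : ‖dilate t x * dilate t y - dilate t y * dilate t x‖ ^ 2 ≤ t ^ 2 := pow_le_pow_left₀ (norm_nonneg _) h1 2
  rw [norm_comm_dilate_sq] at h2
  have h4 : 0 ≤ t ^ 2 * (x.imJ * y.imK - x.imK * y.imJ) ^ 2 := by positivity
  have ht2 : 0 < t ^ 2 := by positivity
  nlinarith

/-- **(b)** from `‖[A, ŷ']‖ ≤ t` (`A` axial): `4A_I²|y_⊥|² ≤ 1`. [folklore] -/
theorem loadB_le_one {t : ℝ} (ht : 0 < t) {A y : ℍ} (hJ : A.imJ = 0) (hK : A.imK = 0) (hy : ‖dilate t y‖ < 1)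
    (h : ‖A * radialUnit (dilate t y) - radialUnit (dilate t y) * A‖ ≤ t) : 4 * (A.imI ^ 2 * (y.imJ ^ 2 + y.imK ^ 2)) ≤ 1 := by
  set v := dilate t y with hv
  have hsq : ‖A * radialUnit v - radialUnit v * A‖ ^ 2 ≤ t ^ 2 := pow_le_pow_left₀ (norm_nonneg _) h 2
  rw [norm_comm_axial_sq A (radialUnit v) hJ hK] at hsq
  obtain ⟨-, -, cJ, cK⟩ := coords_eq_norm_mul_radialUnit v
  -- `v_J = t y_J`, `v_K = t y_K`
  have eJ : t * y.imJ = ‖v‖ * (radialUnit v).imJ := by rw [← cJ, hv, dilate_imJ]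
  have eK : t * y.imK = ‖v‖ * (radialUnit v).imK := by rw [← cK, hv, dilate_imK]
  have hn1 : ‖v‖ ^ 2 ≤ 1 := by nlinarith [norm_nonneg v]
  have key : t ^ 2 * (4 * (A.imI ^ 2 * (y.imJ ^ 2 + y.imK ^ 2))) ≤ t ^ 2 := by
    have e : t ^ 2 * (4 * (A.imI ^ 2 * (y.imJ ^ 2 + y.imK ^ 2))) =
        ‖v‖ ^ 2 * (4 * A.imI ^ 2 * ((radialUnit v).imJ ^ 2 + (radialUnit v).imK ^ 2)) := by
      have h1 : (t * y.imJ) ^ 2 + (t * y.imK) ^ 2 = ‖v‖ ^ 2 * ((radialUnit v).imJ ^ 2 + (radialUnit v).imK ^ 2) := by rw [eJ, eK]; ring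
      linear_combination 4 * A.imI ^ 2 * h1
    rw [e]
    calc ‖v‖ ^ 2 * (4 * A.imI ^ 2 * ((radialUnit v).imJ ^ 2 + (radialUnit v).imK ^ 2)) ≤ ‖v‖ ^ 2 * t ^ 2 :=
          mul_le_mul_of_nonneg_left hsq (sq_nonneg _)
      _ ≤ 1 * t ^ 2 := by gcongr
      _ = t ^ 2 := one_mul _
  have ht2 : 0 < t ^ 2 := by positivity
  exact le_of_mul_le_mul_left (by linarith) ht2

/-- **(c)** from the two seam relations (✓`abs_re_mul_norm_comm_le`: `|A_0|·‖[A, x̂']‖ ≤ 2t`): `A_0²A_I²|x_⊥|² ≤ 1`. [folklore] -/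
theorem loadC_le_one {t : ℝ} (ht : 0 < t) {A x q₁ : ℍ} (hA : ‖A‖ = 1) (hJ : A.imJ = 0) (hK : A.imK = 0) (hx : ‖dilate t x‖ < 1)
    (hT0 : ‖A * q₁ - radialUnit (dilate t x) * A‖ ≤ t) (hT1 : ‖A * radialUnit (dilate t x) - q₁ * A‖ ≤ t) :
    A.re ^ 2 * A.imI ^ 2 * (x.imJ ^ 2 + x.imK ^ 2) ≤ 1 := by
  set v := dilate t x with hv
  have hc := abs_re_mul_norm_comm_le hA hT0 hT1
  have hc0 : 0 ≤ |A.re| * ‖A * radialUnit v - radialUnit v * A‖ := by positivity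
  have hsq : (|A.re| * ‖A * radialUnit v - radialUnit v * A‖) ^ 2 ≤ (2 * t) ^ 2 := pow_le_pow_left₀ hc0 hc 2
  rw [mul_pow, sq_abs, norm_comm_axial_sq A (radialUnit v) hJ hK] at hsq
  obtain ⟨-, -, cJ, cK⟩ := coords_eq_norm_mul_radialUnit v
  have eJ : t * x.imJ = ‖v‖ * (radialUnit v).imJ := by rw [← cJ, hv, dilate_imJ]
  have eK : t * x.imK = ‖v‖ * (radialUnit v).imK := by rw [← cK, hv, dilate_imK]
  have hn1 : ‖v‖ ^ 2 ≤ 1 := by nlinarith [norm_nonneg v]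
  have key : t ^ 2 * (A.re ^ 2 * A.imI ^ 2 * (x.imJ ^ 2 + x.imK ^ 2)) ≤ t ^ 2 := by
    have e : t ^ 2 * (A.re ^ 2 * A.imI ^ 2 * (x.imJ ^ 2 + x.imK ^ 2)) =
        ‖v‖ ^ 2 * (A.re ^ 2 * (4 * A.imI ^ 2 * ((radialUnit v).imJ ^ 2 + (radialUnit v).imK ^ 2))) / 4 := by
      have h1 : (t * x.imJ) ^ 2 + (t * x.imK) ^ 2 = ‖v‖ ^ 2 * ((radialUnit v).imJ ^ 2 + (radialUnit v).imK ^ 2) := by rw [eJ, eK]; ring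
      linear_combination A.re ^ 2 * A.imI ^ 2 * h1
    rw [e]
    have h3 : ‖v‖ ^ 2 * (A.re ^ 2 * (4 * A.imI ^ 2 * ((radialUnit v).imJ ^ 2 + (radialUnit v).imK ^ 2))) ≤ 1 * (2 * t) ^ 2 :=
      mul_le_mul hn1 hsq (by positivity) zero_le_one
    calc ‖v‖ ^ 2 * (A.re ^ 2 * (4 * A.imI ^ 2 * ((radialUnit v).imJ ^ 2 + (radialUnit v).imK ^ 2))) / 4 ≤ 1 * (2 * t) ^ 2 / 4 := by gcongr
      _ = t ^ 2 := by ring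
  have ht2 : 0 < t ^ 2 := by positivity
  exact le_of_mul_le_mul_left (by linarith) ht2

/-- **(d)** from `‖[x̂', q₁]‖ ≤ t` and the first seam relation (✓`norm_comm_conj_le`: `‖[x̂', Ā x̂' A]‖ ≤ 3t`, then
✓`sixteen_mul_le_norm_comm_conj_sq`): `(16/9)A_I²x_I²|x_⊥|² ≤ 1`. [folklore] -/
theorem loadD_le_one {t : ℝ} (ht : 0 < t) {A x q₁ : ℍ} (hA : ‖A‖ = 1) (hJ : A.imJ = 0) (hK : A.imK = 0) (hx : ‖dilate t x‖ < 1)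
    (h01 : ‖radialUnit (dilate t x) * q₁ - q₁ * radialUnit (dilate t x)‖ ≤ t) (hT0 : ‖A * q₁ - radialUnit (dilate t x) * A‖ ≤ t) :
    16 / 9 * (A.imI ^ 2 * x.imI ^ 2 * (x.imJ ^ 2 + x.imK ^ 2)) ≤ 1 := by
  set v := dilate t x with hv
  have hd := norm_comm_conj_le (norm_radialUnit_le_one v) hA h01 hT0
  have h16 := sixteen_mul_le_norm_comm_conj_sq A (radialUnit v) hJ hK (axial_sq_add_sq hA hJ hK)
  have hsq : ‖radialUnit v * (star A * radialUnit v * A) - (star A * radialUnit v * A) * radialUnit v‖ ^ 2 ≤ (3 * t) ^ 2 :=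
    pow_le_pow_left₀ (norm_nonneg _) hd 2
  obtain ⟨-, cI, cJ, cK⟩ := coords_eq_norm_mul_radialUnit v
  have eI : x.imI = ‖v‖ * (radialUnit v).imI := by rw [← cI, hv, dilate_imI]
  have eJ : t * x.imJ = ‖v‖ * (radialUnit v).imJ := by rw [← cJ, hv, dilate_imJ]
  have eK : t * x.imK = ‖v‖ * (radialUnit v).imK := by rw [← cK, hv, dilate_imK]
  have hn1 : ‖v‖ ^ 2 ≤ 1 := by nlinarith [norm_nonneg v]
  have hn4 : ‖v‖ ^ 4 ≤ 1 := by nlinarith [norm_nonneg v]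
  have key : t ^ 2 * (16 / 9 * (A.imI ^ 2 * x.imI ^ 2 * (x.imJ ^ 2 + x.imK ^ 2))) ≤ t ^ 2 := by
    have e : t ^ 2 * (16 / 9 * (A.imI ^ 2 * x.imI ^ 2 * (x.imJ ^ 2 + x.imK ^ 2))) =
        ‖v‖ ^ 4 * (16 * A.imI ^ 2 * (radialUnit v).imI ^ 2 * ((radialUnit v).imJ ^ 2 + (radialUnit v).imK ^ 2)) / 9 := by
      have h1 : (t * x.imJ) ^ 2 + (t * x.imK) ^ 2 = ‖v‖ ^ 2 * ((radialUnit v).imJ ^ 2 + (radialUnit v).imK ^ 2) := by rw [eJ, eK]; ring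
      have h2 : x.imI ^ 2 = ‖v‖ ^ 2 * (radialUnit v).imI ^ 2 := by rw [eI]; ring
      linear_combination (16 / 9) * A.imI ^ 2 * (x.imI ^ 2 * h1 + ‖v‖ ^ 2 * ((radialUnit v).imJ ^ 2 + (radialUnit v).imK ^ 2) * h2)
    rw [e]
    have h3 : ‖v‖ ^ 4 * (16 * A.imI ^ 2 * (radialUnit v).imI ^ 2 * ((radialUnit v).imJ ^ 2 + (radialUnit v).imK ^ 2)) ≤ 1 * (3 * t) ^ 2 :=
      mul_le_mul hn4 (h16.trans hsq) (by positivity) zero_le_one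
    calc ‖v‖ ^ 4 * (16 * A.imI ^ 2 * (radialUnit v).imI ^ 2 * ((radialUnit v).imJ ^ 2 + (radialUnit v).imK ^ 2)) / 9 ≤ 1 * (3 * t) ^ 2 / 9 := by
          gcongr
      _ = t ^ 2 := by ring
  have ht2 : 0 < t ^ 2 := by positivity
  exact le_of_mul_le_mul_left (by linarith) ht2

/-! ## §15 The domination -/

/-- ★★ **THE `t`-FREE DOMINATION**: for `0 < t ≤ 1`, an axial unit hub `A`, and every `((x, y), z)` with `x ≠ 0`,
`𝟙_{rescaledSigma t A}((x,y),z) ≤ sigmaDom A ((x,y),z)`.  (The null set `x = 0` is excluded: there the translated relations do not see `z`.)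
[folklore] -/
theorem indicator_rescaledSigma_le_sigmaDom {t : ℝ} (ht : 0 < t) {A : ℍ} (hA : ‖A‖ = 1) (hJ : A.imJ = 0) (hK : A.imK = 0)
    (w : (ℍ × ℍ) × ℍ) (hx : w.1.1 ≠ 0) :
    (rescaledSigma t A).indicator (1 : (ℍ × ℍ) × ℍ → ℝ≥0∞) w ≤ sigmaDom A w := by
  by_cases hw : w ∈ rescaledSigma t A
  · rw [Set.indicator_of_mem hw, Pi.one_apply]
    obtain ⟨hrel, ⟨hnx, hny⟩, hnz⟩ := (mem_rescaledSigma_iff t A w).1 hw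
    obtain ⟨h01, h02, -, hT0, hT1, hT2⟩ := (mem_sigmaSet_iff t _ _ _ _).1 hrel
    -- the dilated first letter is non-zero, so the slaving unit is a unit
    have hx' : dilate t w.1.1 ≠ 0 := by
      intro h0
      have h1 : (dilate t w.1.1).re = 0 ∧ (dilate t w.1.1).imI = 0 ∧ (dilate t w.1.1).imJ = 0 ∧ (dilate t w.1.1).imK = 0 := by
        rw [h0]; exact ⟨rfl, rfl, rfl, rfl⟩
      rw [dilate_re, dilate_imI, dilate_imJ, dilate_imK] at h1
      obtain ⟨h1, h2, h3, h4⟩ := h1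
      have h3' : w.1.1.imJ = 0 := (mul_eq_zero.1 h3).resolve_left ht.ne'
      have h4' : w.1.1.imK = 0 := (mul_eq_zero.1 h4).resolve_left ht.ne'
      exact hx (Quaternion.ext _ _ h1 h2 h3' h4')
    -- the boxes
    have hbx : w.1.1 ∈ axBox := mem_axBox_of_norm_dilate_lt hnx
    have hby : w.1.2 ∈ axBox := mem_axBox_of_norm_dilate_lt hny
    have hs0 : ‖radialUnit (dilateIm t w.2) - 1‖ ≤ t := by rw [← norm_seam0_translate hA hx']; exact hT0
    have hbz : w.2 ∈ zBox := mem_zBox_of_seam0 ht hnz hs0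
    -- the four loads
    have ha := loadA_le_one ht hnx hny h02
    have hb := loadB_le_one ht hJ hK hny hT2
    have hc := loadC_le_one ht hA hJ hK hnx hT0 hT1
    have hd := loadD_le_one ht hA hJ hK hnx h01 hT0
    have hq : qLoad A w.1.1 w.1.2 ≤ 4 := by rw [qLoad]; linarith
    rw [sigmaDom, Set.indicator_of_mem hbx, Set.indicator_of_mem hby, Set.indicator_of_mem hbz, one_mul, one_mul, one_mul]
    rw [← ENNReal.ofReal_one]
    exact ENNReal.ofReal_le_ofReal (by rw [← Real.exp_zero]; exact Real.exp_le_exp.2 (by linarith))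
  · rw [Set.indicator_of_notMem hw]; exact bot_le

/-- The same at the hub `a ≠ 0` of the cone model (`A = radialUnit (axisPoint a)`). [folklore] -/
theorem indicator_rescaledSigma_axis_le_sigmaDom {t : ℝ} (ht : 0 < t) {a : ℍ} (ha : a ≠ 0) (w : (ℍ × ℍ) × ℍ) (hx : w.1.1 ≠ 0) :
    (rescaledSigma t (radialUnit (axisPoint a))).indicator (1 : (ℍ × ℍ) × ℍ → ℝ≥0∞) w ≤ sigmaDom (radialUnit (axisPoint a)) w :=
  indicator_rescaledSigma_le_sigmaDom ht (norm_axisUnit ha) (axisUnit_axial a).1 (axisUnit_axial a).2 w hx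

end Summit.QuantumFields.YangMills.Theorems.SwapVirialDeficit.ZeroModeSigma

end
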